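import Summits.CriticalPhenomena.PercolationContinuityZ3.Theorems.PercNearOneGluingNoHeavyConstsSingleEdgeValue
import HarnessLib

/-!
# Single-edge extremality at a pair functional is a `3 × 3` MINOR of the avoidance kernel `(T, F) ↦ P(F ∩ {x ↮ T})`
# (PAPER-2 track (ii): constants of the CSH family)

builds on p205010 (kernel theorem, internal audit signed; external expert review pending).  Support file (`--supports
stmt-CriticalPhenomena-4575`), seat `prim-consts-2` (gen 3); rows A6/A11 of `run/shared/lean/prim/consts/CONSTANTS.md`; memo
`run/shared/lean/prim/consts/FROM-prim-consts-2-g3-CHAIN-RULE.md`.  No definitions, no sorries; standard axioms.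

Fix an owner `x`, two pairs `e₁ = s(x,u)`, `e₂ = s(x,v)` at `x`, an observer `o` and an avoided set `Y`; `μ = prodBernoulli w`.  The
AVOIDANCE KERNEL of `x` is `𝒦(T, F) = μ(F ∩ {x ↮ T})` for vertex sets `T` and events `F`; van den Berg–Häggström–Kahn's Theorem 1.1 says
that its `2 × 2` minors with rows `T ⊆ T'` and columns `(Ω, F)`, `F` increasing in `C_x`, are nonnegative.

* `Consts.covD_pairIndicator_eq` — for `f = 1{s(x,u) ∈ 𝐂_x}` (`u ≠ x`) and any target `t`:
  `covD(f, t) = μ(D) μ(D ∩ {x↔t} ∩ {e₁ open}) − μ(D ∩ {e₁ open}) μ(D ∩ {x↔t})`, `D = {x ↮ Y}`.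
* `Consts.see_pairOpen_margin_mul_eq_det` — **IDENTITY.**  With `M = μ(D₁) μ(D ∩ {x↮v})`, `R = μ(D) μ(D₁ ∩ O) − μ(D₁) μ(D ∩ {x↔o})` (the
  brackets of `Consts.SingleEdgeExtremal`), the single-edge-extremality margin at `f₁ = 1{e₁ ∈ 𝐂_x}` satisfies
  `[covD(f₁,o)·M − covD(f₁,v)·R] · covD(f₂, v) = M · μ(D) · det 𝒦[(Y, Y∪{o}, Y∪{v}) × (Ω, {e₁ open}, {e₂ open})]`, `f₂ = 1{e₂ ∈ 𝐂_x}`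
  (by `Consts.covD_pairOpen_cross_eq`, the margin vanishes at `f₂`, and Chiò condensation of the `3 × 3` determinant).
* Consequence (informal here; NOT a declaration of this file): for non-degenerate data (weights in `(0,1)`, `x ≠ u`, `x ≠ v`, `x, v ∉ Y`,
  so that `covD(f₂, v) > 0` and `M μ(D) > 0`) SEE holds at `f₁` iff the `3 × 3` minor `det [μ(F_j ∩ {x ↮ T_i})]`, `T = (Y, Y∪{o}, Y∪{v})`,
  `F = (Ω, {e₁ open}, {e₂ open})`, is nonnegative.  The kernel-checked "iff" is stated for the DISCONNECTION kernel instead: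
  `Consts.singleEdgeChainRule_iff_det_nonneg` (file `…ConstsSingleEdgeDisconnection.lean`; chain rule ⟺ `det[μ{S_i ↮ T_j}] ≥ 0`), and the
  chain rule is equivalent to SEE on single-pair functionals by `…ChainRuleSEECor` / `…ChainRuleOfSEE`.
  So SEE on single-pair functionals (equivalently the chain rule `Consts.SingleEdgeChainRule`, files `…ChainRuleSEE*`, `…ChainRuleOfSEE`)
  is an order-3 sign-regularity of the avoidance kernel whose order-2 sign-regularity is vdBHK's Theorem 1.1; numerically (exact, n ≤ 7)
  this minor is never negative, while `3 × 3` minors along chains `T₁ ⊂ T₂ ⊂ T₃` not tied to the column pairs take both signs.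
[cite: VandenbergHaggstromKahn2005, Thm. 1.1 (pp. 3–5)]
-/

noncomputable section

namespace Summit.CriticalPhenomena.PercolationContinuityZ3.Theorems

open MeasureTheory Set Literature.Probability.LatticeModels Literature.Probability.Percolation
open scoped Classical

namespace Consts

variable {V : Type*} [Fintype V]

/-- The covariance bracket at a single-pair functional, in closed form (no pinning): for `e = s(x,u)`, `x ≠ u`, and any target `t`,
`covD(1{e ∈ ·}, t) = μ(D) μ(D ∩ {x ↔ t} ∩ {e open}) − μ(D ∩ {e open}) μ(D ∩ {x ↔ t})`. [folklore] -/
theorem covD_pairIndicator_eq (w : Sym2 V → unitInterval) (x u t : V) (Y : Set V) (hxu : x ≠ u) :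
    CSH.covD w x Y (fun C => if s(x, u) ∈ C then (1 : ℝ) else 0) t =
      (prodBernoulli w).real {ω : BondConfig V | ∀ y ∈ Y, ¬ (openGraph ω).Reachable x y} *
          (prodBernoulli w).real ({ω : BondConfig V | ∀ y ∈ Y, ¬ (openGraph ω).Reachable x y} ∩ openConn x t ∩
            {ω | s(x, u) ∈ ω}) -
        (prodBernoulli w).real ({ω : BondConfig V | ∀ y ∈ Y, ¬ (openGraph ω).Reachable x y} ∩ {ω | s(x, u) ∈ ω}) *
          (prodBernoulli w).real ({ω : BondConfig V | ∀ y ∈ Y, ¬ (openGraph ω).Reachable x y} ∩ openConn x t) := by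
  classical
  set μ := prodBernoulli w with hμ
  have hmeas : ∀ T : Set (BondConfig V), MeasurableSet T := fun _ => MeasurableSet.of_discrete
  have hf : ∀ ω : BondConfig V, (fun C : Set (Sym2 V) => if s(x, u) ∈ C then (1 : ℝ) else 0) (openEdgeCluster ω x) =
      ({ω : BondConfig V | s(x, u) ∈ ω}).indicator 1 ω := by
    intro ω
    simp only [CSH.pair_mem_openEdgeCluster_iff hxu]
    exact TwoSetConditionalAssociation.predIndicator_eq_indicator (fun ω' => s(x, u) ∈ ω') ω
  unfold CSH.covD
  simp_rw [hf]
  rw [TripodExchange.setIntegral_indicator_one_eq, TripodExchange.setIntegral_indicator_one_eq]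

/-- **IDENTITY: the SEE margin at `1{s(x,u) ∈ 𝐂_x}` times `covD(1{s(x,v) ∈ 𝐂_x}, v)` is `M · μ(D)` times the `3 × 3` minor of the
avoidance kernel** with rows `T = (Y, Y ∪ {o}, Y ∪ {v})` and columns `F = (Ω, {s(x,u) open}, {s(x,v) open})`:
`[covD(f₁,o) M − covD(f₁,v) R] · covD(f₂,v) = M · μ(D) · det[μ(F_j ∩ {x ↮ T_i})]` (`M = μ(D₁) μ(D ∩ {x↮v})`,
`R = μ(D) μ(D₁ ∩ O) − μ(D₁) μ(D ∩ {x↔o})`, `D = {x↮Y}`, `D₁ = D ∩ {v↮Y}`, `O = {x↔o} ∪ {v↔o}`). [folklore] -/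
theorem see_pairOpen_margin_mul_eq_det (w : Sym2 V → unitInterval) (x u v o : V) (Y : Set V) (hxu : x ≠ u) (hxv : x ≠ v) :
    (CSH.covD w x Y (fun C => if s(x, u) ∈ C then (1 : ℝ) else 0) o *
          ((prodBernoulli w).real
              {ω : BondConfig V | ∀ y ∈ Y, ¬ (openGraph ω).Reachable x y ∧ ¬ (openGraph ω).Reachable v y} *
            (prodBernoulli w).real
              ({ω : BondConfig V | ∀ y ∈ Y, ¬ (openGraph ω).Reachable x y} ∩ {ω | ¬ (openGraph ω).Reachable x v})) -
        CSH.covD w x Y (fun C => if s(x, u) ∈ C then (1 : ℝ) else 0) v *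
          ((prodBernoulli w).real {ω : BondConfig V | ∀ y ∈ Y, ¬ (openGraph ω).Reachable x y} *
              (prodBernoulli w).real
                ({ω : BondConfig V | ∀ y ∈ Y, ¬ (openGraph ω).Reachable x y ∧ ¬ (openGraph ω).Reachable v y} ∩
                  (openConn x o ∪ openConn v o)) -
            (prodBernoulli w).real
                {ω : BondConfig V | ∀ y ∈ Y, ¬ (openGraph ω).Reachable x y ∧ ¬ (openGraph ω).Reachable v y} *
              (prodBernoulli w).real ({ω : BondConfig V | ∀ y ∈ Y, ¬ (openGraph ω).Reachable x y} ∩ openConn x o))) *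
      CSH.covD w x Y (fun C => if s(x, v) ∈ C then (1 : ℝ) else 0) v =
    ((prodBernoulli w).real
          {ω : BondConfig V | ∀ y ∈ Y, ¬ (openGraph ω).Reachable x y ∧ ¬ (openGraph ω).Reachable v y} *
        (prodBernoulli w).real
          ({ω : BondConfig V | ∀ y ∈ Y, ¬ (openGraph ω).Reachable x y} ∩ {ω | ¬ (openGraph ω).Reachable x v})) *
      (prodBernoulli w).real {ω : BondConfig V | ∀ y ∈ Y, ¬ (openGraph ω).Reachable x y} *
      Matrix.det !![
        (prodBernoulli w).real {ω : BondConfig V | ∀ y ∈ Y, ¬ (openGraph ω).Reachable x y},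
          (prodBernoulli w).real ({ω : BondConfig V | ∀ y ∈ Y, ¬ (openGraph ω).Reachable x y} ∩ {ω | s(x, u) ∈ ω}),
          (prodBernoulli w).real ({ω : BondConfig V | ∀ y ∈ Y, ¬ (openGraph ω).Reachable x y} ∩ {ω | s(x, v) ∈ ω});
        (prodBernoulli w).real {ω : BondConfig V | ∀ y ∈ insert o Y, ¬ (openGraph ω).Reachable x y},
          (prodBernoulli w).real ({ω : BondConfig V | ∀ y ∈ insert o Y, ¬ (openGraph ω).Reachable x y} ∩ {ω | s(x, u) ∈ ω}),
          (prodBernoulli w).real ({ω : BondConfig V | ∀ y ∈ insert o Y, ¬ (openGraph ω).Reachable x y} ∩ {ω | s(x, v) ∈ ω});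
        (prodBernoulli w).real {ω : BondConfig V | ∀ y ∈ insert v Y, ¬ (openGraph ω).Reachable x y},
          (prodBernoulli w).real ({ω : BondConfig V | ∀ y ∈ insert v Y, ¬ (openGraph ω).Reachable x y} ∩ {ω | s(x, u) ∈ ω}),
          (prodBernoulli w).real ({ω : BondConfig V | ∀ y ∈ insert v Y, ¬ (openGraph ω).Reachable x y} ∩ {ω | s(x, v) ∈ ω})] := by
  classical
  set μ := prodBernoulli w with hμ
  have hmeas : ∀ T : Set (BondConfig V), MeasurableSet T := fun _ => MeasurableSet.of_discrete
  set D : Set (BondConfig V) := {ω | ∀ y ∈ Y, ¬ (openGraph ω).Reachable x y} with hD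
  set D₁ : Set (BondConfig V) := {ω | ∀ y ∈ Y, ¬ (openGraph ω).Reachable x y ∧ ¬ (openGraph ω).Reachable v y} with hD₁
  set E₁ : Set (BondConfig V) := {ω | s(x, u) ∈ ω} with hE₁
  set E₂ : Set (BondConfig V) := {ω | s(x, v) ∈ ω} with hE₂
  set A : Set (BondConfig V) := openConn x o with hA
  set B : Set (BondConfig V) := openConn x v with hB
  -- the avoidance rows `Y ∪ {o}`, `Y ∪ {v}` as differences
  have hRo : {ω : BondConfig V | ∀ y ∈ insert o Y, ¬ (openGraph ω).Reachable x y} = D \ A := by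
    ext ω; simp only [mem_setOf_eq, mem_insert_iff, forall_eq_or_imp, hD, hA, mem_sdiff, openConn]; tauto
  have hRv : {ω : BondConfig V | ∀ y ∈ insert v Y, ¬ (openGraph ω).Reachable x y} = D \ B := by
    ext ω; simp only [mem_setOf_eq, mem_insert_iff, forall_eq_or_imp, hD, hB, mem_sdiff, openConn]; tauto
  have hdiff : ∀ S T : Set (BondConfig V), μ.real (D \ S ∩ T) = μ.real (D ∩ T) - μ.real (D ∩ S ∩ T) := by
    intro S T
    have h := measureReal_inter_add_sdiff (μ := μ) (s := D ∩ T) (hmeas S)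
    have h1 : D ∩ T ∩ S = D ∩ S ∩ T := by ext ω; simp only [mem_inter_iff]; tauto
    have h2 : (D ∩ T) \ S = D \ S ∩ T := by ext ω; simp only [mem_inter_iff, mem_sdiff]; tauto
    rw [h1, h2] at h; linarith
  have hdiff0 : ∀ S : Set (BondConfig V), μ.real (D \ S) = μ.real D - μ.real (D ∩ S) := by
    intro S
    have h := measureReal_inter_add_sdiff (μ := μ) (s := D) (hmeas S)
    linarith
  rw [hRo, hRv, hdiff0 A, hdiff0 B, hdiff A E₁, hdiff A E₂, hdiff B E₁, hdiff B E₂]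
  -- the covariances in closed form
  rw [covD_pairIndicator_eq w x u o Y hxu, covD_pairIndicator_eq w x u v Y hxu, covD_pairIndicator_eq w x v v Y hxv]
  -- `R · covD(f₂, v) = covD(f₂, o) · M` (the margin vanishes at `f₂`)
  have cross := covD_pairOpen_cross_eq w x o v Y hxv
  rw [covD_pairIndicator_eq w x v o Y hxv, covD_pairIndicator_eq w x v v Y hxv] at cross
  -- `D ∩ B ∩ E₂ = D ∩ E₂` (the open pair `s(x,v)` joins `v` to `x`)
  have hBE₂ : D ∩ B ∩ E₂ = D ∩ E₂ := by
    ext ω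
    simp only [mem_inter_iff, hB, hE₂, mem_setOf_eq, openConn]
    constructor
    · rintro ⟨⟨hD', -⟩, he⟩; exact ⟨hD', he⟩
    · rintro ⟨hD', he⟩; exact ⟨⟨hD', SimpleGraph.Adj.reachable ((openGraph_adj ω x v).2 ⟨he, hxv⟩)⟩, he⟩
  rw [hBE₂] at cross ⊢
  rw [Matrix.det_fin_three]
  simp only [Matrix.of_apply, Matrix.cons_val', Matrix.cons_val_zero, Matrix.cons_val_one, Matrix.cons_val_two,
    Matrix.empty_val', Matrix.cons_val_fin_one, Matrix.vecHead, Matrix.vecTail, Function.comp_apply, Fin.succ_zero_eq_one]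
  -- change of variables and `ring`, using `cross`
  set d : ℝ := μ.real D
  set d1 : ℝ := μ.real D₁
  set dA : ℝ := μ.real (D ∩ A)
  set dB : ℝ := μ.real (D ∩ B)
  set dE₁ : ℝ := μ.real (D ∩ E₁)
  set dE₂ : ℝ := μ.real (D ∩ E₂)
  set dAE₁ : ℝ := μ.real (D ∩ A ∩ E₁)
  set dAE₂ : ℝ := μ.real (D ∩ A ∩ E₂)
  set dBE₁ : ℝ := μ.real (D ∩ B ∩ E₁)
  set m : ℝ := d1 * μ.real (D ∩ {ω | ¬ (openGraph ω).Reachable x v})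
  set r : ℝ := d * μ.real (D₁ ∩ (openConn x o ∪ openConn v o)) - d1 * dA
  -- cross : (d * dAE₂ - dE₂ * dA) * m = (d * dE₂ - dE₂ * dB) * r
  linear_combination (d * dBE₁ - dE₁ * dB) * cross

end Consts

end Summit.CriticalPhenomena.PercolationContinuityZ3.Theorems

end
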